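/-
Copyright (c) 2026 the pub-hodgecm-mathlib formalisation cell (harness21).  Prover seat hodgecm-mathlib-K2E3-p12 (g3), Track B «K2-LIT» ∕ h413
(`stmt-HodgeConjecture-24833`), line `K2_E3_EllipticInputs`, unit U12-d, §L at `N = 2`: STRUCTURE OF THE REGULAR NILPOTENT ORBIT OF `𝔤𝔩₂(F)` —
`𝒩 ∖ {0} = Ad(GL₂(𝒪)) · (Fˣ E₁₂)` (rank-one normal form + Iwasawa), the SUPPORT TEST it yields for `GL₂(𝒪)`-invariant test functions, and the
HOMOGENEITY `μ_reg(f(c ·)) = |c|_F⁻¹ μ_reg(f)` of the regular nilpotent orbital measure.  2026-09-04.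
-/
import Summits.HodgeConjecture.HodgeConjecture.Theorems.K2E3GL2RegularNilpotentOrbitalMeasure   -- ★ p856734 (this seat): `μ_reg`, the four `J(𝒩)` clauses
import Literature.NumberTheory.Automorphic.IwasawaHaarGL2                                    -- ★ `mem_standardParabolicGL_fin_two_iff`
import Mathlib.LinearAlgebra.Matrix.Charpoly.Coeff
import Mathlib.MeasureTheory.Measure.WithDensity
import HarnessLib

/-!
# K2_E3 road (h413), §L at `N = 2` — the regular nilpotent orbit of `𝔤𝔩₂(F)`: `K × Fˣ` normal form, support test, homogeneity of `μ_reg`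

Cell `pub/hodgecm-mathlib` (D-0151), Track B, seat K2E3-p12 (g3), §L line lead (dealer K2E3-plan (g2), D20); self-deal (b0) announced on the squad bus
2026-09-04T02:18Z.  `--supports stmt-HodgeConjecture-24833 --as helper`; THEOREMS ONLY (no definition ∕ instance ∕ notation ∕ named fact ∕ `sorry`); never
imports `Cruxes/…/Lines`.

Context.  (L-B_GL) at `N = 2` (`sig_K2E3GLnNilpotentFourierRegular`, U12 ED. 7 :310) is Harish-Chandra's regularity theorem for the two-dimensional space
`J(𝒩)(𝔤𝔩₂(F)) = ℂ δ₀ ⊕ ℂ μ_reg`; ★ p856457 pays the `δ₀`-summand and ★ p856734 puts `μ_reg(f) = ∫_{GL₂(𝒪) × F} f(k (tE₁₂) k⁻¹)` in `J(𝒩) ∖ ℂδ₀`.  What the socket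
still owes at `N = 2` is (a) the STRUCTURE statement `J(𝒩) ⊆ ℂδ₀ + ℂμ_reg` and (b) the REGULARITY of `μ̂_reg`.  This file supplies three inputs common to both
[HarishChandra1999AdmissibleDistributions, §3 pp. 8–10 (Deligne–Rao: the invariant measure of a nilpotent orbit and its homogeneity), Lemma 3.2, Cor. 3.10]:
* §1 **normal form** — `exists_units_conj_nilp_one_eq`: a non-zero nilpotent `X ∈ 𝔤𝔩₂(F)` (any field) is `g E₁₂ g⁻¹` (`g = [Xv | v]` for any `v` with
  `Xv ≠ 0`, invertible by `Matrix.mulVec_injective_iff_isUnit`); `borel_conj_nilp_one` : `b E₁₂ b⁻¹ = (b₀₀/b₁₁) E₁₂` for `b` upper triangular; hence, by the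
  Iwasawa decomposition ★ `GL2.exists_glInt_mul_borel`, **`exists_glInt_conj_nilp_eq`** : `X = k (tE₁₂) k⁻¹` with `k ∈ GL₂(𝒪)`, `t ≠ 0` — i.e.
  `𝒩 ∖ {0} = Ad(K)(Fˣ E₁₂)`, Rao's `K × Fˣ` chart of the regular nilpotent orbit.
* §2 **support test** — `not_isNilpotent_of_mem_tsupport`: a locally constant `Ad(GL₂(𝒪))`-invariant `f` vanishing at `0` and on the punctured line
  `Fˣ E₁₂` has NO nilpotent element in `tsupport f` (= `support f`, clopen); so clause (iv) of `J(𝒩)` kills it (`apply_eq_zero_of_glInt_invariant`) — the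
  "restriction to the orbit" step of (a): an invariant `T ∈ J(𝒩)` evaluated on `K`-invariant test functions away from `0` factors through the profile
  `t ↦ f(tE₁₂)`.
* §3 **homogeneity** — `smul_conj_nilp` : `c • (k (tE₁₂) k⁻¹) = k ((ct)E₁₂) k⁻¹` and **`nilpotentAverage_comp_smul`** :
  `μ_reg(f(c ·)) = |c⁻¹|_F · μ_reg(f)` for `c ≠ 0` (substitution `t ↦ ct` in the `F`-variable, ★ Tate `map_mul_left_addHaar`; no integrability needed),
  against `δ₀(f(c ·)) = δ₀(f)`: the two generators are eigenvectors of the dilation action with DIFFERENT characters (`1` and `|c|⁻¹`), the first input of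
  Harish-Chandra's homogeneity argument (Lemma 3.2) for (b).
Scope: (a) the structure theorem itself (uniqueness of SIGNED invariant functionals on `C_c^∞(Ad(K)(FˣE₁₂))`) and (b) are NOT proved here.

References: [HarishChandra1999AdmissibleDistributions] Harish-Chandra, *Admissible invariant distributions on reductive p-adic groups* (notes by DeBacker–Sally), AMS
ULECT 16 (1999), §3 pp. 8–10, Lemma 3.2, Thm. 3.9, Cor. 3.10 · [Rogawski1990] J. D. Rogawski, *Automorphic Representations of Unitary Groups in Three Variables* (1990), §8.1 p. 112.
-/

set_option autoImplicit false
set_option linter.dupNamespace false   -- `Summit.HodgeConjecture.HodgeConjecture.…` (D-0017 nested layout; lakefile exemption for Summits)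

noncomputable section

open MeasureTheory Measure Filter Topology
open scoped MatrixGroups NNReal ENNReal
open Literature.NumberTheory.Rogawski1990 Literature.NumberTheory.Automorphic Literature.NumberTheory.Automorphic.LocalFieldHaar
open Literature.NumberTheory.GaloisRepresentations Literature.NumberTheory.GaloisRepresentations.IsNonarchimedeanLocalField
open Summit.HodgeConjecture.HodgeConjecture.Cruxes.H413.K2E3GL2RegularNilpotentOrbitalMeasure

namespace Summit.HodgeConjecture.HodgeConjecture.Cruxes.H413.K2E3GL2RegularNilpotentOrbitStructure

variable {F : Type*} [Field F]

/-! ## §1  Normal form: `𝒩 ∖ {0} = Ad(GL₂(𝒪)) · (Fˣ E₁₂)` -/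

/-- **Rank-one normal form**: a non-zero nilpotent `X ∈ 𝔤𝔩₂(F)` over any field is `GL₂(F)`-conjugate to `E₁₂` — `X = g E₁₂ g⁻¹` with `g = [Xv | v]` for
any `v` with `Xv ≠ 0` (`X² = 0` by Cayley–Hamilton). [cite: HarishChandra1999AdmissibleDistributions, §3 p. 8] -/
theorem exists_units_conj_nilp_one_eq {X : Matrix (Fin 2) (Fin 2) F} (hX : IsNilpotent X) (h0 : X ≠ 0) :
    ∃ g : GL (Fin 2) F, (g : Matrix (Fin 2) (Fin 2) F) * !![0, 1; 0, 0] * ((g⁻¹ : GL (Fin 2) F) : Matrix (Fin 2) (Fin 2) F) = X := by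
  -- `X² = 0`
  have hsq : X * X = 0 := by
    have h1 : X.charpoly = Polynomial.X ^ 2 := by
      have h := (Matrix.isNilpotent_charpoly_sub_pow_of_isNilpotent hX).eq_zero
      rw [sub_eq_zero] at h
      simpa using h
    have h2 := Matrix.aeval_self_charpoly X
    rwa [h1, map_pow, Polynomial.aeval_X, pow_two] at h2
  -- a vector `v` with `Xv ≠ 0`
  obtain ⟨i, j, hij⟩ : ∃ i j, X i j ≠ 0 := by
    by_contra h
    push Not at h
    exact h0 (Matrix.ext fun i j => by rw [h i j]; rfl)
  set v : Fin 2 → F := Pi.single j 1 with hv_def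
  have hv : X.mulVec v ≠ 0 := by
    intro h
    have := congr_fun h i
    rw [hv_def, Matrix.mulVec_single_one] at this
    exact hij this
  set u : Fin 2 → F := X.mulVec v with hu_def
  have hXu : X.mulVec u = 0 := by rw [hu_def, Matrix.mulVec_mulVec, hsq, Matrix.zero_mulVec]
  -- `g = [u | v]`
  set gM : Matrix (Fin 2) (Fin 2) F := !![u 0, v 0; u 1, v 1] with hgM_def
  have hgM : ∀ d : Fin 2 → F, gM.mulVec d = d 0 • u + d 1 • v := by
    intro d
    ext l
    fin_cases l <;> simp [hgM_def, Matrix.mulVec, dotProduct, Fin.sum_univ_two] <;> ring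
  have hinj : Function.Injective gM.mulVec := by
    intro d d' hdd'
    have hd : gM.mulVec (d - d') = 0 := by rw [Matrix.mulVec_sub, hdd', sub_self]
    rw [hgM] at hd
    have h1 : (d - d') 1 = 0 := by
      have := congr_arg X.mulVec hd
      rw [Matrix.mulVec_add, Matrix.mulVec_smul, Matrix.mulVec_smul, hXu, smul_zero, zero_add, Matrix.mulVec_zero, ← hu_def] at this
      exact (smul_eq_zero.1 this).resolve_right hv
    have h0' : (d - d') 0 = 0 := by
      rw [h1, zero_smul, add_zero] at hd
      exact (smul_eq_zero.1 hd).resolve_right (by rw [hu_def]; exact hv)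
    rw [← sub_eq_zero]
    ext l
    fin_cases l
    · exact h0'
    · exact h1
  obtain ⟨g, hg⟩ := Matrix.mulVec_injective_iff_isUnit.1 hinj
  refine ⟨g, ?_⟩
  -- `g E₁₂ = X g` (columns: `[0 | u] = [Xu | Xv]`)
  have hXu' : ∀ l, X l 0 * u 0 + X l 1 * u 1 = 0 := fun l => by
    have := congr_fun hXu l; simpa [Matrix.mulVec, dotProduct, Fin.sum_univ_two] using this
  have hXv' : ∀ l, X l 0 * v 0 + X l 1 * v 1 = u l := fun l => by
    have : u l = X.mulVec v l := by rw [hu_def]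
    rw [this]; simp [Matrix.mulVec, dotProduct, Fin.sum_univ_two]
  have key : (g : Matrix (Fin 2) (Fin 2) F) * !![0, 1; 0, 0] = X * (g : Matrix (Fin 2) (Fin 2) F) := by
    rw [hg]
    ext l m
    fin_cases l <;> fin_cases m <;> simp [hgM_def, Matrix.mul_apply, Fin.sum_univ_two, hXu', hXv']
  rw [key, Matrix.mul_assoc, Units.mul_inv, Matrix.mul_one]

/-- **`b E₁₂ b⁻¹ = (b₀₀ / b₁₁) E₁₂`** for an upper triangular `b ∈ GL₂(F)`: the Borel subgroup acts on the line `F E₁₂` through the positive root.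
[cite: HarishChandra1999AdmissibleDistributions, §3 p. 9] -/
theorem borel_conj_nilp_one {b : GL (Fin 2) F} (hb : b ∈ standardParabolicGL F (id : Fin 2 → Fin 2)) :
    (b : Matrix (Fin 2) (Fin 2) F) * !![0, 1; 0, 0] * ((b⁻¹ : GL (Fin 2) F) : Matrix (Fin 2) (Fin 2) F) =
      !![0, (b : Matrix (Fin 2) (Fin 2) F) 0 0 * ((b : Matrix (Fin 2) (Fin 2) F) 1 1)⁻¹; 0, 0] := by
  have h10 : (b : Matrix (Fin 2) (Fin 2) F) 1 0 = 0 := mem_standardParabolicGL_fin_two_iff.1 hb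
  have h11 : (b : Matrix (Fin 2) (Fin 2) F) 1 1 ≠ 0 := by
    intro h
    have hdet : (b : Matrix (Fin 2) (Fin 2) F).det = 0 := by rw [Matrix.det_fin_two, h10, h, mul_zero, mul_zero, sub_zero]
    exact (Matrix.isUnit_iff_isUnit_det _ |>.1 (Units.isUnit b)).ne_zero hdet
  have key : (b : Matrix (Fin 2) (Fin 2) F) * !![0, 1; 0, 0] =
      !![0, (b : Matrix (Fin 2) (Fin 2) F) 0 0 * ((b : Matrix (Fin 2) (Fin 2) F) 1 1)⁻¹; 0, 0] * (b : Matrix (Fin 2) (Fin 2) F) := by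
    ext l m
    fin_cases l <;> fin_cases m <;> simp [Matrix.mul_apply, Fin.sum_univ_two, h10, h11]
  rw [key, Matrix.mul_assoc, Units.mul_inv, Matrix.mul_one]

/-- **`𝒩 ∖ {0} = Ad(GL₂(𝒪)) · (Fˣ E₁₂)`** (Rao's `K × Fˣ` chart of the regular nilpotent orbit): every non-zero nilpotent `X ∈ 𝔤𝔩₂(F)` is `k (tE₁₂) k⁻¹` with
`k ∈ GL₂(𝒪)` and `t ≠ 0` — normal form §1 followed by the Iwasawa decomposition `GL₂(F) = GL₂(𝒪) B` (★ `GL2.exists_glInt_mul_borel`) and `borel_conj_nilp_one`.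
[cite: HarishChandra1999AdmissibleDistributions, §3 p. 9] -/
theorem exists_glInt_conj_nilp_eq [ValuativeRel F] {X : Matrix (Fin 2) (Fin 2) F} (hX : IsNilpotent X) (h0 : X ≠ 0) :
    ∃ k ∈ glInt 2 F, ∃ t : F, t ≠ 0 ∧
      ((k : GL (Fin 2) F) : Matrix (Fin 2) (Fin 2) F) * !![0, t; 0, 0] * ((k⁻¹ : GL (Fin 2) F) : Matrix (Fin 2) (Fin 2) F) = X := by
  obtain ⟨g, hg⟩ := exists_units_conj_nilp_one_eq hX h0
  obtain ⟨k, hk, b, hb, hgkb⟩ := GL2.exists_glInt_mul_borel g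
  have h10 : (b : Matrix (Fin 2) (Fin 2) F) 1 0 = 0 := mem_standardParabolicGL_fin_two_iff.1 hb
  have hdet : (b : Matrix (Fin 2) (Fin 2) F).det ≠ 0 := (Matrix.isUnit_iff_isUnit_det _ |>.1 (Units.isUnit b)).ne_zero
  rw [Matrix.det_fin_two, h10, mul_zero, sub_zero] at hdet
  refine ⟨k, hk, (b : Matrix (Fin 2) (Fin 2) F) 0 0 * ((b : Matrix (Fin 2) (Fin 2) F) 1 1)⁻¹,
    mul_ne_zero (left_ne_zero_of_mul hdet) (inv_ne_zero (right_ne_zero_of_mul hdet)), ?_⟩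
  rw [← hg, hgkb, _root_.mul_inv_rev, Units.val_mul, Units.val_mul, ← borel_conj_nilp_one hb]
  simp only [Matrix.mul_assoc]

/-! ## §2  Support test for `Ad(GL₂(𝒪))`-invariant test functions -/

/-- The support of a locally constant function is closed (indeed clopen), so `tsupport f = support f`. [folklore] -/
theorem tsupport_eq_support_of_isLocallyConstant {X M : Type*} [TopologicalSpace X] [Zero M] {f : X → M} (hf : IsLocallyConstant f) :
    tsupport f = Function.support f := by
  have hcl : IsClosed (Function.support f) := by
    have h : Function.support f = (f ⁻¹' {0})ᶜ := by ext x; simp [Function.mem_support]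
    rw [h]
    exact (hf {0}).isClosed_compl
  exact hcl.closure_eq

/-- **Support test**: a locally constant `Ad(GL₂(𝒪))`-invariant `f` on `𝔤𝔩₂(F)` with `f(0) = 0` and `f(tE₁₂) = 0` for all `t ≠ 0` has no nilpotent element
in its (topological) support — by §1 every non-zero nilpotent is `k (tE₁₂) k⁻¹`. [cite: HarishChandra1999AdmissibleDistributions, §3 p. 9] -/
theorem not_isNilpotent_of_mem_tsupport [ValuativeRel F] [TopologicalSpace F] {M : Type*} [Zero M] {f : Matrix (Fin 2) (Fin 2) F → M}
    (hf : IsLocallyConstant f)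
    (hK : ∀ k ∈ glInt 2 F, ∀ X : Matrix (Fin 2) (Fin 2) F,
      f (((k : GL (Fin 2) F) : Matrix (Fin 2) (Fin 2) F) * X * ((k⁻¹ : GL (Fin 2) F) : Matrix (Fin 2) (Fin 2) F)) = f X)
    (hE : ∀ t : F, t ≠ 0 → f !![0, t; 0, 0] = 0) (h0 : f 0 = 0) :
    ∀ X ∈ tsupport f, ¬ IsNilpotent X := by
  intro X hX hnil
  rw [tsupport_eq_support_of_isLocallyConstant hf, Function.mem_support] at hX
  by_cases hX0 : X = 0
  · exact hX (by rw [hX0, h0])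
  · obtain ⟨k, hk, t, ht, hkt⟩ := exists_glInt_conj_nilp_eq hnil hX0
    exact hX (by rw [← hkt, hK k hk, hE t ht])

/-- **Clause (iv) of `J(𝒩)` kills invariant test functions with vanishing profile**: if `T` vanishes on test functions whose support meets no nilpotent
(clause (iv)), then `T f = 0` for every `f ∈ C_c^∞(𝔤𝔩₂(F))` which is `Ad(GL₂(𝒪))`-invariant, vanishes at `0` and on `Fˣ E₁₂` — the restriction-to-the-orbit
step of the structure theorem `J(𝒩) = ℂδ₀ ⊕ ℂμ_reg`. [cite: HarishChandra1999AdmissibleDistributions, §3 p. 10, Cor. 3.10] -/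
theorem apply_eq_zero_of_glInt_invariant [ValuativeRel F] [TopologicalSpace F] {T : (Matrix (Fin 2) (Fin 2) F → ℂ) → ℂ}
    (hT : ∀ f : Matrix (Fin 2) (Fin 2) F → ℂ, IsLocSmooth f → (∀ X ∈ tsupport f, ¬ IsNilpotent X) → T f = 0)
    {f : Matrix (Fin 2) (Fin 2) F → ℂ} (hf : IsLocSmooth f)
    (hK : ∀ k ∈ glInt 2 F, ∀ X : Matrix (Fin 2) (Fin 2) F,
      f (((k : GL (Fin 2) F) : Matrix (Fin 2) (Fin 2) F) * X * ((k⁻¹ : GL (Fin 2) F) : Matrix (Fin 2) (Fin 2) F)) = f X)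
    (hE : ∀ t : F, t ≠ 0 → f !![0, t; 0, 0] = 0) (h0 : f 0 = 0) :
    T f = 0 :=
  hT f hf (not_isNilpotent_of_mem_tsupport hf.1 hK hE h0)

/-! ## §3  Homogeneity of `μ_reg` under dilations -/

/-- `c • (k (tE₁₂) k⁻¹) = k ((ct) E₁₂) k⁻¹`: dilation acts on the `K × F` chart through the `F`-coordinate. [folklore] -/
theorem smul_conj_nilp (c t : F) (k : GL (Fin 2) F) :
    c • ((k : Matrix (Fin 2) (Fin 2) F) * !![0, t; 0, 0] * ((k⁻¹ : GL (Fin 2) F) : Matrix (Fin 2) (Fin 2) F)) =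
      (k : Matrix (Fin 2) (Fin 2) F) * !![0, c * t; 0, 0] * ((k⁻¹ : GL (Fin 2) F) : Matrix (Fin 2) (Fin 2) F) := by
  have hE : (!![0, c * t; 0, 0] : Matrix (Fin 2) (Fin 2) F) = c • !![0, t; 0, 0] := by
    ext l m; fin_cases l <;> fin_cases m <;> simp
  rw [hE, Matrix.mul_smul, Matrix.smul_mul]

variable [ValuativeRel F] [TopologicalSpace F] [IsNonarchimedeanLocalField F] [MeasurableSpace F] [BorelSpace F]
  [MeasurableSpace (GL (Fin 2) F)]

/-- **Homogeneity of the regular nilpotent orbital measure**: `μ_reg(f(c ·)) = |c⁻¹|_F · μ_reg(f)` for `c ≠ 0` and ANY `f` (substitution `t ↦ ct` in the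
`F`-coordinate of the `K × F` chart: `(t ↦ ct)_* dx = |c⁻¹|_F dx`, ★ `map_mul_left_addHaar`; no integrability hypothesis).  Since `δ₀(f(c ·)) = δ₀(f)`, the two
generators `δ₀`, `μ_reg` of `J(𝒩)(𝔤𝔩₂(F))` are dilation eigenvectors with distinct eigencharacters. [cite: HarishChandra1999AdmissibleDistributions, §3 Lemma 3.2] -/
theorem nilpotentAverage_comp_smul (κ : Measure ↥(glInt 2 F)) [SFinite κ] (dx : Measure F) [dx.IsAddHaarMeasure] {c : F} (hc : c ≠ 0)
    (f : Matrix (Fin 2) (Fin 2) F → ℂ) :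
    ∫ p : ↥(glInt 2 F) × F, f (c • (((p.1 : GL (Fin 2) F) : Matrix (Fin 2) (Fin 2) F) * !![0, p.2; 0, 0] *
        ((((p.1 : GL (Fin 2) F))⁻¹ : GL (Fin 2) F) : Matrix (Fin 2) (Fin 2) F))) ∂(κ.prod dx) =
      ((normAbs F c⁻¹ : ℝ≥0) : ℝ) • ∫ p : ↥(glInt 2 F) × F, f (((p.1 : GL (Fin 2) F) : Matrix (Fin 2) (Fin 2) F) * !![0, p.2; 0, 0] *
        ((((p.1 : GL (Fin 2) F))⁻¹ : GL (Fin 2) F) : Matrix (Fin 2) (Fin 2) F)) ∂(κ.prod dx) := by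
  haveI : T2Space F := (isLocalField F).toT2Space
  haveI : SecondCountableTopology F := secondCountableTopology_localField F
  simp only [smul_conj_nilp]
  set g : ↥(glInt 2 F) × F → ℂ := fun p => f (((p.1 : GL (Fin 2) F) : Matrix (Fin 2) (Fin 2) F) * !![0, p.2; 0, 0] *
    ((((p.1 : GL (Fin 2) F))⁻¹ : GL (Fin 2) F) : Matrix (Fin 2) (Fin 2) F)) with hg_def
  set e : ↥(glInt 2 F) × F ≃ᵐ ↥(glInt 2 F) × F := (MeasurableEquiv.refl _).prodCongr (MeasurableEquiv.mulLeft₀ c hc) with he_def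
  have he : (e : ↥(glInt 2 F) × F → ↥(glInt 2 F) × F) = Prod.map id (fun x => c * x) := rfl
  have hmap : Measure.map e (κ.prod dx) = ((normAbs F c⁻¹ : ℝ≥0) : ℝ≥0∞) • κ.prod dx := by
    rw [he, ← Measure.map_prod_map κ dx measurable_id (measurable_const_mul c), Measure.map_id, map_mul_left_addHaar dx hc,
      Measure.prod_smul_right]
  have h := integral_map_equiv (μ := κ.prod dx) e g
  rw [hmap, integral_smul_measure, ENNReal.coe_toReal, he] at h
  show ∫ p : ↥(glInt 2 F) × F, g (Prod.map id (fun x => c * x) p) ∂(κ.prod dx) = ((normAbs F c⁻¹ : ℝ≥0) : ℝ) • ∫ p, g p ∂(κ.prod dx)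
  rw [← h]

omit [MeasurableSpace (GL (Fin 2) F)] in
/-- The same homogeneity with the scalar written in `ℂ`: `μ_reg(f(c ·)) = |c|_F⁻¹ · μ_reg(f)`. [cite: HarishChandra1999AdmissibleDistributions, §3 Lemma 3.2] -/
theorem nilpotentAverage_comp_smul' [MeasurableSpace (GL (Fin 2) F)] (κ : Measure ↥(glInt 2 F)) [SFinite κ] (dx : Measure F) [dx.IsAddHaarMeasure]
    {c : F} (hc : c ≠ 0) (f : Matrix (Fin 2) (Fin 2) F → ℂ) :
    ∫ p : ↥(glInt 2 F) × F, f (c • (((p.1 : GL (Fin 2) F) : Matrix (Fin 2) (Fin 2) F) * !![0, p.2; 0, 0] *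
        ((((p.1 : GL (Fin 2) F))⁻¹ : GL (Fin 2) F) : Matrix (Fin 2) (Fin 2) F))) ∂(κ.prod dx) =
      (((normAbs F c : ℝ≥0) : ℂ))⁻¹ * ∫ p : ↥(glInt 2 F) × F, f (((p.1 : GL (Fin 2) F) : Matrix (Fin 2) (Fin 2) F) * !![0, p.2; 0, 0] *
        ((((p.1 : GL (Fin 2) F))⁻¹ : GL (Fin 2) F) : Matrix (Fin 2) (Fin 2) F)) ∂(κ.prod dx) := by
  rw [nilpotentAverage_comp_smul κ dx hc f, map_inv₀, NNReal.coe_inv, Complex.real_smul, Complex.ofReal_inv]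

end Summit.HodgeConjecture.HodgeConjecture.Cruxes.H413.K2E3GL2RegularNilpotentOrbitStructure
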